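import Literature.RingTheory.KTheory.MilnorKModTwo
import Literature.RingTheory.KTheory.MilnorKGroupsFiniteField
import Mathlib.NumberTheory.LegendreSymbol.QuadraticChar.Basic
import HarnessLib

/-!
# `k_*F` for quadratically closed and finite fields (Milnor, *Algebraic K-theory and quadratic forms*,
# Invent. Math. 9 (1970), §1 Example 1.5 and §4 Lemma 4.6)

Family `hodge`, lane `lit-hodgefound` (foundations library; seat `lit-hodgefound-p27`, generation 40, row g40-#12);
topic `RingTheory/KTheory`.  Sequel of `MilnorKModTwo` (g40-#9: `k_nF = K_nF/2K_nF`, `kSymbol`, `kOneEquiv : k₁ ≅ F•/F•²`,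
the invisibility of squares) and `MilnorKGroupsFiniteField` (g39-#13: EXAMPLE 1.5, `K_nF = 0` for finite `F`, `n ≥ 2`);
Mathlib's `FiniteField.exists_nonsquare` and the quadratic character `quadraticChar`.  PROVED THEOREMS only; no
definition, no named fact, no instance, no notation, 0 `sorry`, net debt 0 (D-0026).

## The source, verbatim

J. Milnor, *Algebraic K-theory and quadratic forms*, Invent. Math. 9 (1970) 318–344 (held `paper:doi-10-1007-bf01425486`;
bib key `Milnor1970`), §1 Example 1.5 (p0004 L7–L12): «If the field is finite, then K₂F = 0. In fact K₁F is cyclic,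
say of order q − 1 […] This implies, of course, that K_nF = 0 for n > 2 also»; §3 (p0010 L30–L31): «k_*F is a
graded algebra over Z/2Z, with k₁F ≅ F•/F•²»; §4, Lemma 4.6 and its proof (p0016 L21–L24): «Now suppose that F is a
field such that k₂F has at most two distinct elements. […] Notice that this includes the case of a finite, or local,
or real closed, or quadratically closed field».

## What is formalised

* `kSymbol_const_eq_zero_iff : {a} = 0 ∈ k₁R ↔ a is a square` (through `kOneEquiv`), `kSymbol_eq_zero_of_sq`.
* **quadratically closed** (every unit a square): **`mod2_eq_zero_of_forall_sq : k_nR = 0` for `n ≥ 1`**.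
* **finite fields**: **`mod2_eq_zero_of_finite : k_nF = 0` for `n ≥ 2`** (EXAMPLE 1.5); in odd characteristic
  `exists_kSymbol_ne_zero` (a non-square gives `{z} ≠ 0`), **`kSymbol_const_eq_of_ne_zero`** (the product of two
  non-squares is a square — Mathlib's quadratic character — so all non-zero classes `{a} ∈ k₁F` coincide) and
  **`eq_zero_or_eq_kSymbol_of_finite : k₁F = {0, {z}}`**, i.e. `k₁F ≅ F•/F•² ≅ ℤ/2` («K₁F is cyclic, say of order
  q − 1»).  (The real closed case is `MilnorKModTwoReal`.)

## References

* [Milnor1970] J. Milnor, *Algebraic K-theory and quadratic forms*, Invent. Math. 9 (1970) 318–344 — §1 Example 1.5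
  (p0004 L7–L12); §3 (p0010 L30–L31); §4 Lemma 4.6 (p0016 L21–L24).

Provenance: lane `lit-hodgefound`, seat `lit-hodgefound-p27` gen 40 (agent `literature-prover-lit-hodgefound-p27-g40-0`),
row g40-#12.
-/

set_option autoImplicit false

noncomputable section

namespace Literature.RingTheory.KTheory

namespace MilnorK

open Function

section Ring

variable {R : Type*} [CommRing R] {n : ℕ}

/-- **`{a} = 0` in `k₁R` iff `a` is a square** (`k₁R ≅ R•/R•²`, `kOneEquiv`). [cite: Milnor1970, §3 «k₁F ≅ F•/F•²» (p0010 L31)] -/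
theorem kSymbol_const_eq_zero_iff (a : Rˣ) : kSymbol (fun _ : Fin 1 => a) = 0 ↔ ∃ u : Rˣ, u ^ 2 = a := by
  rw [← (kOneEquiv R).injective.eq_iff, map_zero, kOneEquiv_kSymbol, QuotientAddGroup.eq_zero_iff,
    mem_range_two_zsmul_iff]
  rfl

/-- A symbol with a square entry vanishes in `k_nR`. [cite: Milnor1970, §3 «k₁F ≅ F•/F•²» (p0010 L31)] -/
theorem kSymbol_eq_zero_of_sq (a : Fin n → Rˣ) (i : Fin n) (u : Rˣ) (h : u ^ 2 = a i) : kSymbol a = 0 := by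
  have : a = update a i (u ^ 2) := by rw [h, update_eq_self]
  rw [this]
  exact kSymbol_update_sq a i u

/-- **Quadratically closed: if every unit is a square then `k_nR = 0` for all `n ≥ 1`.** [cite: Milnor1970, §4 Lemma 4.6 «this includes the case of a […] quadratically closed field» (p0016 L21–L24)] -/
theorem mod2_eq_zero_of_forall_sq (h : ∀ a : Rˣ, ∃ u : Rˣ, u ^ 2 = a) (x : Mod2 R (n + 1)) : x = 0 := by
  obtain ⟨z, rfl⟩ := kmk_surjective x
  induction z using induction_on with
  | hsym k a =>
    obtain ⟨u, hu⟩ := h (a 0)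
    rw [map_zsmul, ← kSymbol_def, kSymbol_eq_zero_of_sq a 0 u hu, zsmul_zero]
  | hadd x y hx hy => rw [map_add, hx, hy, add_zero]

end Ring

/-! ### finite fields -/

section Field

variable {F : Type*} [Field F] {n : ℕ}

/-- **EXAMPLE 1.5 modulo `2`: over a finite field `k_nF = 0` for `n ≥ 2`** (`K_nF = 0`, `MilnorKGroupsFiniteField`). [cite: Milnor1970, §1 Example 1.5 (p0004 L7–L12); §4 Lemma 4.6 «the case of a finite […] field» (p0016 L21–L24)] -/
theorem mod2_eq_zero_of_finite [Finite F] (x : Mod2 F (n + 2)) : x = 0 := by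
  obtain ⟨z, rfl⟩ := kmk_surjective x
  rw [eq_zero_of_finite z, map_zero]

/-- A unit is a square in the field iff it is the square of a unit. [folklore] -/
private theorem isSquare_coe_iff (a : Fˣ) : IsSquare (a : F) ↔ ∃ u : Fˣ, u ^ 2 = a := by
  constructor
  · rintro ⟨r, hr⟩
    have hr0 : r ≠ 0 := by
      rintro rfl
      rw [mul_zero] at hr
      exact a.ne_zero hr
    exact ⟨Units.mk0 r hr0, Units.ext (by rw [Units.val_pow_eq_pow_val, Units.val_mk0, hr, sq])⟩
  · rintro ⟨u, rfl⟩
    exact ⟨u, by rw [Units.val_pow_eq_pow_val, sq]⟩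

end Field

section Finite

variable {F : Type*} [Field F] [Fintype F]

/-- Over a finite field of odd characteristic `k₁F ≠ 0`: a non-square `z` (Mathlib's `FiniteField.exists_nonsquare`)
has `{z} ≠ 0`. [cite: Milnor1970, §1 Example 1.5 (p0004 L7–L12); §4 Lemma 4.6 «the case of a finite […] field» (p0016 L21–L24)] -/
theorem exists_kSymbol_ne_zero (hF : ringChar F ≠ 2) : ∃ z : Fˣ, kSymbol (fun _ : Fin 1 => z) ≠ 0 := by
  obtain ⟨a, ha⟩ := FiniteField.exists_nonsquare hF
  have ha0 : a ≠ 0 := by rintro rfl; exact ha (IsSquare.zero)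
  refine ⟨Units.mk0 a ha0, fun h => ha ?_⟩
  rw [kSymbol_const_eq_zero_iff, ← isSquare_coe_iff, Units.val_mk0] at h
  exact h

variable [DecidableEq F]

/-- **Over a finite field all non-zero classes of `k₁F` coincide**: the product of two non-squares is a square (the
quadratic character is multiplicative), so `{a} + {z} = {az} = 0`. («K₁F is cyclic, say of order q − 1».) [cite: Milnor1970, §1 Example 1.5 (p0004 L7–L12); §4 Lemma 4.6 «the case of a finite […] field» (p0016 L21–L24)] -/
theorem kSymbol_const_eq_of_ne_zero {z a : Fˣ} (hz : kSymbol (fun _ : Fin 1 => z) ≠ 0)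
    (ha : kSymbol (fun _ : Fin 1 => a) ≠ 0) : kSymbol (fun _ : Fin 1 => a) = kSymbol (fun _ : Fin 1 => z) := by
  rw [Ne, kSymbol_const_eq_zero_iff, ← isSquare_coe_iff, ← quadraticChar_neg_one_iff_not_isSquare] at hz ha
  have haz : IsSquare ((a * z : Fˣ) : F) := by
    rw [← quadraticChar_one_iff_isSquare (a * z).ne_zero, Units.val_mul, map_mul, ha, hz]; norm_num
  rw [isSquare_coe_iff] at haz
  obtain ⟨u, hu⟩ := haz
  have h0 : kSymbol (fun _ : Fin 1 => a) + kSymbol (fun _ : Fin 1 => z) = 0 := by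
    rw [← kSymbol_const_mul, ← hu]
    exact (kSymbol_const_eq_zero_iff _).2 ⟨u, rfl⟩
  rw [← neg_eq_self' (kSymbol fun _ : Fin 1 => z)]
  exact eq_neg_of_add_eq_zero_left h0

/-- **Over a finite field of odd characteristic `k₁F = {0, {z}}` for any non-square `z`** — `k₁F ≅ F•/F•²` is cyclic
of order `2`. [cite: Milnor1970, §1 Example 1.5 (p0004 L7–L12); §4 Lemma 4.6 «the case of a finite […] field» (p0016 L21–L24)] -/
theorem eq_zero_or_eq_kSymbol_of_finite {z : Fˣ} (hz : kSymbol (fun _ : Fin 1 => z) ≠ 0) (x : Mod2 F 1) :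
    x = 0 ∨ x = kSymbol (fun _ : Fin 1 => z) := by
  obtain ⟨w, rfl⟩ := kmk_surjective x
  induction w using induction_on with
  | hsym k a =>
    rw [map_zsmul, ← kSymbol_def]
    have ha : (fun j : Fin 1 => a j) = fun _ => a 0 := funext fun j => by rw [Subsingleton.elim j 0]
    rw [show a = fun _ => a 0 from ha]
    by_cases h0 : kSymbol (fun _ : Fin 1 => a 0) = 0
    · left; rw [h0, zsmul_zero]
    · rw [kSymbol_const_eq_of_ne_zero hz h0]
      rcases Int.even_or_odd k with hk | hk
      · left; rw [kSymbol_def, ← map_zsmul]; exact kmk_zsmul_even hk _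
      · right
        obtain ⟨j, rfl⟩ := hk
        rw [add_zsmul, one_zsmul, kSymbol_def, ← map_zsmul, kmk_zsmul_even (even_two_mul j), zero_add]
  | hadd x y hx hy =>
    rw [map_add]
    rcases hx with hx | hx <;> rcases hy with hy | hy <;> rw [hx, hy]
    · left; rw [add_zero]
    · right; rw [zero_add]
    · right; rw [add_zero]
    · left; exact add_self_eq_zero _

end Finite

end MilnorK

end Literature.RingTheory.KTheory

end
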